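import Summits.Ventures.HodgeRepro2.T5CyclotomicSevenInertPrime
import Summits.Ventures.HodgeRepro2.T5RecordSatakeInertToyDegree
import Summits.Ventures.HodgeRepro2.T5RecordSatakeDegreeCells
import Summits.Ventures.HodgeRepro2.T5RecordSatakeToy

/-!
# The record's spherical Hecke algebra on the FIELD OF RECORD `ℚ(ζ₇)` at every inert place `(p)`, `p` of order `6`
# modulo `7`: `q = p³`

Tier-5 support N3 / §G-N4.2 (seat p3, gen 78). File 256 exhibits, for every rational prime `p` of order `6` modulo
`7`, the place `(p)` of `ℚ(ζ₇)⁺` that stays prime in the sextic Galois CM field of record `ℚ(ζ₇)`, with `N(v) = p³`.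
This file reads the Satake chain of the record's own pair (files 233 / 236 / 245 / 248 / 251) at every such place,
with the Gram matrix `H₀ = diag(1, 1, −1)` of file 237 — file 254 (`p = 3`) generalised, with `q = p³`:

* **`heckeAlgebra_mul_comm_record_seven_prime`**, **`nonempty_algEquiv_polynomial_record_seven_prime`** —
  `H(U(1 ⊗ H₀), K_{(p)})` is commutative and `≃ k[X]` for every family `l` of generators and every field `k`;
* **`exists_doubleCosetOp_aeval_bijective_and_ncard_record_seven_prime`** — the generator `T₁ = 1_{K_v g₀ K_v}` has
  `deg T₁ = p¹² + p³ = q⁴ + q`;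
* **`exists_cells_ncard_and_three_term_record_seven_prime`** — cells `gₙ` with `deg Tₙ = (p⁹ + 1) (p³)^{4n−3}`
  (`n ≥ 1`), `deg T₀ = 1`, `T₁ T_{n+2} = T_{n+3} + (p³ − 1) T_{n+2} + p¹² T_{n+1}` and
  `T₁² = T₂ + (p³ − 1) T₁ + (p¹² + p³) T₀` (`k` of characteristic `0`);
* the instance `p = 5` (`q = 125`): `exists_doubleCosetOp_aeval_bijective_and_ncard_record_seven_five`
  (`deg T₁ = 244140750`), `exists_cells_ncard_and_three_term_record_seven_five` (the recursion with
  `124`, `244140625`, `244140750`).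

§8(d): uses an L-value-free non-vanishing device: NO.
-/

open Matrix NumberField NumberField.IsCMField IsDedekindDomain IsDedekindDomain.HeightOneSpectrum Module Polynomial
  MulAction
open scoped TensorProduct Pointwise
open Summit.Ventures.HodgeRepro2.T5UnitaryGroupForm Summit.Ventures.HodgeRepro2.T5UnitaryHeckeAdjoint
  Summit.Ventures.HodgeRepro2.T5HeckePermutationModule Summit.Ventures.HodgeRepro2.T5HeckeDoubleCoset
  Summit.Ventures.HodgeRepro2.T5RecordHyperspecial Summit.Ventures.HodgeRepro2.T5GlobalLatticeAlmostAll
  Summit.Ventures.HodgeRepro2.T5FinitePlaceSplitClassification Summit.Ventures.HodgeRepro2.T5RecordSatakeIntrinsic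
  Summit.Ventures.HodgeRepro2.T5CMFieldSquareDatum Summit.Ventures.HodgeRepro2.T5RecordSatakeToy
  Summit.Ventures.HodgeRepro2.T5RecordSatakeDegreeIntrinsic
  Summit.Ventures.HodgeRepro2.T5RecordSatakeRecurrenceIntrinsic
  Summit.Ventures.HodgeRepro2.T5SplitPlaceUnitaryGroup Summit.Ventures.HodgeRepro2.T5NonSplitPlaceUnitaryGroup
  Summit.Ventures.HodgeRepro2.T5FinitePlaceCM Summit.Ventures.HodgeRepro2.T5StarOfInvolution
  Summit.Ventures.HodgeRepro2.T5RecordSatake Summit.Ventures.HodgeRepro2.T5RecordSatakeInert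
  Summit.Ventures.HodgeRepro2.T5RecordSatakeCell Summit.Ventures.HodgeRepro2.T5RecordSatakeDegree
  Summit.Ventures.HodgeRepro2.T5RecordSatakeRecurrence Summit.Ventures.HodgeRepro2.T5RecordSatakeInertToyDegree
  Summit.Ventures.HodgeRepro2.T5RecordSatakeDegreeCells Summit.Ventures.HodgeRepro2.T5CyclotomicSevenInertThree
  Summit.Ventures.HodgeRepro2.T5CyclotomicSevenInertPrime

namespace Summit.Ventures.HodgeRepro2.T5RecordSatakeSevenPrime

section Record

variable (K : Type*) [Field K] [CharZero K] [IsCyclotomicExtension {7} ℚ K]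
variable (p : ℕ) [hp : Fact p.Prime] (h6 : orderOf (p : ZMod 7) = 6)

/-- **THE RECORD'S SPHERICAL HECKE ALGEBRA ON `ℚ(ζ₇)` AT EVERY INERT PLACE `(p)` IS COMMUTATIVE** (file 236's
`heckeAlgebra_mul_comm_record_of_staysPrime` with `hmap := map_vPrime`, `H := H₀`). -/
theorem heckeAlgebra_mul_comm_record_seven_prime (k : Type*) [Field k] {r : ℕ} (l : Fin r → 𝓞 K)
    (hl : Submodule.span (𝓞 (maximalRealSubfield K)) (Set.range l) = ⊤)
    (T S : (haveI := numberField' K; haveI := isCMField' K; letI := tensorStarRing K (vPrime K p h6);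
      ↥(heckeAlgebra k (recordHyperspecial K (vPrime K p h6) l (gramToy K))))) :
    T * S = S * T :=
  haveI := numberField' K
  haveI := isCMField' K
  heckeAlgebra_mul_comm_record_of_staysPrime K (vPrime K p h6) (wPrime K p h6) l k hl (map_vPrime K p h6)
    gramToy_isHermitian isUnit_det_gramToy (notMem_badSet_gramToy _) T S

/-- **THE RECORD'S SPHERICAL HECKE ALGEBRA ON `ℚ(ζ₇)` AT EVERY INERT PLACE `(p)` IS `k[X]`** — the Satake chain
read on the record's own pair at an infinite family of inert places of the FIELD OF RECORD (file 236's
`nonempty_algEquiv_polynomial_record_of_staysPrime`). -/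
theorem nonempty_algEquiv_polynomial_record_seven_prime (k : Type*) [Field k] {r : ℕ} (l : Fin r → 𝓞 K)
    (hl : Submodule.span (𝓞 (maximalRealSubfield K)) (Set.range l) = ⊤) :
    haveI := numberField' K; haveI := isCMField' K
    Nonempty (Polynomial k ≃ₐ[k]
      (letI := tensorStarRing K (vPrime K p h6);
        ↥(heckeAlgebra k (recordHyperspecial K (vPrime K p h6) l (gramToy K))))) :=
  haveI := numberField' K
  haveI := isCMField' K
  nonempty_algEquiv_polynomial_record_of_staysPrime K (vPrime K p h6) (wPrime K p h6) l k hl (map_vPrime K p h6)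
    gramToy_isHermitian isUnit_det_gramToy (notMem_badSet_gramToy _)

/-- **`deg T₁ = p¹² + p³` AT THE INERT PLACE `(p)` OF `ℚ(ζ₇)`** (file 245's datum-free generator with
`(N(v)³ + 1) · N(v) = (p⁹ + 1) p³ = q⁴ + q`, `q = p³`): for every family `l` of generators of `𝓞_{ℚ(ζ₇)}` over
`𝓞_{ℚ(ζ₇)⁺}` and every field `k`, some `g₀ ∈ U(1 ⊗ H₀)` has a double coset `K_{(p)} g₀ K_{(p)}` of exactly
`p¹² + p³` left cosets whose characteristic function `T₁` generates `H(U(1 ⊗ H₀), K_{(p)})`. -/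
theorem exists_doubleCosetOp_aeval_bijective_and_ncard_record_seven_prime (k : Type*) [Field k] {r : ℕ}
    (l : Fin r → 𝓞 K) (hl : Submodule.span (𝓞 (maximalRealSubfield K)) (Set.range l) = ⊤) :
    haveI := numberField' K; haveI := isCMField' K
    ∃ g₀ : (letI := tensorStarRing K (vPrime K p h6);
        ↥(formUnitaryGroup (tensorGram K (vPrime K p h6) (gramToy K)))),
      (orbit (recordHyperspecial K (vPrime K p h6) l (gramToy K))
        (g₀ : _ ⧸ recordHyperspecial K (vPrime K p h6) l (gramToy K))).ncard = p ^ 12 + p ^ 3 ∧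
      ∃ _ : Finite (orbit (recordHyperspecial K (vPrime K p h6) l (gramToy K))
          (g₀ : _ ⧸ recordHyperspecial K (vPrime K p h6) l (gramToy K))),
        Function.Bijective (aeval (doubleCosetOp k (recordHyperspecial K (vPrime K p h6) l (gramToy K)) g₀) :
          k[X] →ₐ[k] heckeAlgebra k (recordHyperspecial K (vPrime K p h6) l (gramToy K))) := by
  haveI := numberField' K
  haveI := isCMField' K
  have key := @exists_doubleCosetOp_aeval_bijective_and_ncard_record_of_staysPrime K _ (numberField' K)
    (isCMField' K) (vPrime K p h6) (wPrime K p h6) _ (map_vPrime K p h6) _ l k _ hl _ gramToy_isHermitian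
    isUnit_det_gramToy (notMem_badSet_gramToy _)
  obtain ⟨g₀, hn, hb⟩ := key
  exact ⟨g₀, hn.trans (by rw [absNorm_vPrime K p h6]; ring), hb⟩

/-- **THE DEGREES OF ALL THE CELLS AND THE TREE RECURSION AT THE INERT PLACE `(p)` OF `ℚ(ζ₇)`, `q = p³`**
(file 251's datum-free theorem with `N(v) = p³`): for every family `l` of generators of `𝓞_{ℚ(ζ₇)}` over
`𝓞_{ℚ(ζ₇)⁺}` and every field `k` of characteristic `0`, cells `gₙ ∈ U(1 ⊗ H₀)` with
`#(K_{(p)} gₙ K_{(p)} / K_{(p)}) = (p⁹ + 1) (p³)^{4n−3}` (`n ≥ 1`), `#(K_{(p)} g₀ K_{(p)} / K_{(p)}) = 1`, and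
`Tₙ := 1_{K_{(p)} gₙ K_{(p)}}` satisfying `T₁ T_{n+2} = T_{n+3} + (p³ − 1) T_{n+2} + p¹² T_{n+1}` and
`T₁² = T₂ + (p³ − 1) T₁ + (p¹² + p³) T₀`. -/
theorem exists_cells_ncard_and_three_term_record_seven_prime (k : Type*) [Field k] [CharZero k] {r : ℕ}
    (l : Fin r → 𝓞 K) (hl : Submodule.span (𝓞 (maximalRealSubfield K)) (Set.range l) = ⊤) :
    haveI := numberField' K; haveI := isCMField' K
    ∃ g : ℕ → (letI := tensorStarRing K (vPrime K p h6);
        ↥(formUnitaryGroup (tensorGram K (vPrime K p h6) (gramToy K)))),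
      (∀ n, 1 ≤ n → (orbit (recordHyperspecial K (vPrime K p h6) l (gramToy K))
        (g n : _ ⧸ recordHyperspecial K (vPrime K p h6) l (gramToy K))).ncard = (p ^ 9 + 1) * (p ^ 3) ^ (4 * n - 3)) ∧
      (orbit (recordHyperspecial K (vPrime K p h6) l (gramToy K))
        (g 0 : _ ⧸ recordHyperspecial K (vPrime K p h6) l (gramToy K))).ncard = 1 ∧
      ∃ hfin : ∀ n, Finite (orbit (recordHyperspecial K (vPrime K p h6) l (gramToy K))
          (g n : _ ⧸ recordHyperspecial K (vPrime K p h6) l (gramToy K))),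
        (∀ n, letI := hfin 1; letI := hfin (n + 1 + 1); letI := hfin (n + 1 + 1 + 1); letI := hfin (n + 1);
          doubleCosetOp k (recordHyperspecial K (vPrime K p h6) l (gramToy K)) (g 1) *
              doubleCosetOp k (recordHyperspecial K (vPrime K p h6) l (gramToy K)) (g (n + 1 + 1)) =
            doubleCosetOp k (recordHyperspecial K (vPrime K p h6) l (gramToy K)) (g (n + 1 + 1 + 1)) +
              ((p : k) ^ 3 - 1) • doubleCosetOp k (recordHyperspecial K (vPrime K p h6) l (gramToy K)) (g (n + 1 + 1)) +
              (p : k) ^ 12 • doubleCosetOp k (recordHyperspecial K (vPrime K p h6) l (gramToy K)) (g (n + 1))) ∧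
        (letI := hfin 1; letI := hfin (0 + 1); letI := hfin (0 + 1 + 1); letI := hfin 0;
          doubleCosetOp k (recordHyperspecial K (vPrime K p h6) l (gramToy K)) (g 1) *
              doubleCosetOp k (recordHyperspecial K (vPrime K p h6) l (gramToy K)) (g (0 + 1)) =
            doubleCosetOp k (recordHyperspecial K (vPrime K p h6) l (gramToy K)) (g (0 + 1 + 1)) +
              ((p : k) ^ 3 - 1) • doubleCosetOp k (recordHyperspecial K (vPrime K p h6) l (gramToy K)) (g (0 + 1)) +
              ((p : k) ^ 12 + (p : k) ^ 3) •
                doubleCosetOp k (recordHyperspecial K (vPrime K p h6) l (gramToy K)) (g 0)) := by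
  haveI := numberField' K
  haveI := isCMField' K
  have e1 : ((Ideal.absNorm (vPrime K p h6).asIdeal : k) - 1) = (p : k) ^ 3 - 1 := by
    rw [absNorm_vPrime K p h6, Nat.cast_pow]
  have e2 : (Ideal.absNorm (vPrime K p h6).asIdeal : k) ^ 4 = (p : k) ^ 12 := by
    rw [absNorm_vPrime K p h6, Nat.cast_pow, ← pow_mul]
  have e3 : (Ideal.absNorm (vPrime K p h6).asIdeal : k) ^ 4 + Ideal.absNorm (vPrime K p h6).asIdeal =
      (p : k) ^ 12 + (p : k) ^ 3 := by
    rw [absNorm_vPrime K p h6, Nat.cast_pow, ← pow_mul]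
  have key := @exists_cells_three_term_and_ncard_record_of_staysPrime' K _ (numberField' K) (isCMField' K)
    (vPrime K p h6) (wPrime K p h6) _ (map_vPrime K p h6) _ l k _ _ hl _ gramToy_isHermitian isUnit_det_gramToy
    (notMem_badSet_gramToy _)
  obtain ⟨g, hdeg, hdeg0, hfin, h1, h2⟩ := key
  exact ⟨g, fun n hn => (hdeg n hn).trans (by rw [absNorm_vPrime K p h6]; ring), hdeg0, hfin,
    fun n => three_term_congr e1 e2 (h1 n), three_term_congr e1 e3 h2⟩


/-- **THE GENERATOR AT `(5)` ON `ℚ(ζ₇)`: `deg T₁ = 125⁴ + 125 = 244140750`.** -/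
theorem exists_doubleCosetOp_aeval_bijective_and_ncard_record_seven_five (k : Type*) [Field k] {r : ℕ}
    (l : Fin r → 𝓞 K) (hl : Submodule.span (𝓞 (maximalRealSubfield K)) (Set.range l) = ⊤) :
    haveI := numberField' K; haveI := isCMField' K; haveI := fact_prime_five
    ∃ g₀ : (letI := tensorStarRing K (vPrime K 5 orderOf_natCast_five_zmod_seven);
        ↥(formUnitaryGroup (tensorGram K (vPrime K 5 orderOf_natCast_five_zmod_seven) (gramToy K)))),
      (orbit (recordHyperspecial K (vPrime K 5 orderOf_natCast_five_zmod_seven) l (gramToy K))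
        (g₀ : _ ⧸ recordHyperspecial K (vPrime K 5 orderOf_natCast_five_zmod_seven) l (gramToy K))).ncard =
          244140750 ∧
      ∃ _ : Finite (orbit (recordHyperspecial K (vPrime K 5 orderOf_natCast_five_zmod_seven) l (gramToy K))
          (g₀ : _ ⧸ recordHyperspecial K (vPrime K 5 orderOf_natCast_five_zmod_seven) l (gramToy K))),
        Function.Bijective (aeval (doubleCosetOp k
          (recordHyperspecial K (vPrime K 5 orderOf_natCast_five_zmod_seven) l (gramToy K)) g₀) :
          k[X] →ₐ[k]
            heckeAlgebra k (recordHyperspecial K (vPrime K 5 orderOf_natCast_five_zmod_seven) l (gramToy K))) :=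
  haveI := numberField' K
  haveI := isCMField' K
  haveI := fact_prime_five
  (exists_doubleCosetOp_aeval_bijective_and_ncard_record_seven_prime K 5 (hp := fact_prime_five)
    orderOf_natCast_five_zmod_seven k l hl).elim fun g₀ h => h.elim fun h1 h2 => ⟨g₀, h1.trans (by norm_num), h2⟩

/-- **THE TREE RECURSION AT `(5)` ON `ℚ(ζ₇)`, AS NUMERALS**: `T₁ T_{n+2} = T_{n+3} + 124 T_{n+2} + 244140625 T_{n+1}`
and `T₁² = T₂ + 124 T₁ + 244140750 T₀`. -/
theorem exists_cells_three_term_record_seven_five (k : Type*) [Field k] [CharZero k] {r : ℕ}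
    (l : Fin r → 𝓞 K) (hl : Submodule.span (𝓞 (maximalRealSubfield K)) (Set.range l) = ⊤) :
    haveI := numberField' K; haveI := isCMField' K; haveI := fact_prime_five
    ∃ g : ℕ → (letI := tensorStarRing K (vPrime K 5 orderOf_natCast_five_zmod_seven);
        ↥(formUnitaryGroup (tensorGram K (vPrime K 5 orderOf_natCast_five_zmod_seven) (gramToy K)))),
      ∃ hfin : ∀ n, Finite (orbit (recordHyperspecial K (vPrime K 5 orderOf_natCast_five_zmod_seven) l (gramToy K))
          (g n : _ ⧸ recordHyperspecial K (vPrime K 5 orderOf_natCast_five_zmod_seven) l (gramToy K))),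
        (∀ n, letI := hfin 1; letI := hfin (n + 1 + 1); letI := hfin (n + 1 + 1 + 1); letI := hfin (n + 1);
          doubleCosetOp k (recordHyperspecial K (vPrime K 5 orderOf_natCast_five_zmod_seven) l (gramToy K)) (g 1) *
              doubleCosetOp k (recordHyperspecial K (vPrime K 5 orderOf_natCast_five_zmod_seven) l (gramToy K))
                (g (n + 1 + 1)) =
            doubleCosetOp k (recordHyperspecial K (vPrime K 5 orderOf_natCast_five_zmod_seven) l (gramToy K))
                (g (n + 1 + 1 + 1)) +
              (124 : k) • doubleCosetOp k (recordHyperspecial K (vPrime K 5 orderOf_natCast_five_zmod_seven) l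
                (gramToy K)) (g (n + 1 + 1)) +
              (244140625 : k) • doubleCosetOp k (recordHyperspecial K (vPrime K 5 orderOf_natCast_five_zmod_seven) l
                (gramToy K)) (g (n + 1))) ∧
        (letI := hfin 1; letI := hfin (0 + 1); letI := hfin (0 + 1 + 1); letI := hfin 0;
          doubleCosetOp k (recordHyperspecial K (vPrime K 5 orderOf_natCast_five_zmod_seven) l (gramToy K)) (g 1) *
              doubleCosetOp k (recordHyperspecial K (vPrime K 5 orderOf_natCast_five_zmod_seven) l (gramToy K))
                (g (0 + 1)) =
            doubleCosetOp k (recordHyperspecial K (vPrime K 5 orderOf_natCast_five_zmod_seven) l (gramToy K))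
                (g (0 + 1 + 1)) +
              (124 : k) • doubleCosetOp k (recordHyperspecial K (vPrime K 5 orderOf_natCast_five_zmod_seven) l
                (gramToy K)) (g (0 + 1)) +
              (244140750 : k) • doubleCosetOp k (recordHyperspecial K (vPrime K 5 orderOf_natCast_five_zmod_seven) l
                (gramToy K)) (g 0)) := by
  haveI := numberField' K
  haveI := isCMField' K
  haveI := fact_prime_five
  have e1 : (((5 : ℕ) : k) ^ 3 - 1) = 124 := by norm_num
  have e2 : ((5 : ℕ) : k) ^ 12 = 244140625 := by norm_num
  have e3 : ((5 : ℕ) : k) ^ 12 + ((5 : ℕ) : k) ^ 3 = 244140750 := by norm_num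
  have key := exists_cells_ncard_and_three_term_record_seven_prime K 5 (hp := fact_prime_five)
    orderOf_natCast_five_zmod_seven k l hl
  obtain ⟨g, _, _, hfin, h1, h2⟩ := key
  exact ⟨g, hfin, fun n => three_term_congr e1 e2 (h1 n), three_term_congr e1 e3 h2⟩

end Record

end Summit.Ventures.HodgeRepro2.T5RecordSatakeSevenPrime
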